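/-
Copyright: pub-hodgecm formalisation cell (harness21, 2026). New file (not vendored).
-/
import Summits.HodgeConjecture.HodgeCM.Proofs.Prop22.Basic

/-!
# rfwf Prop 2.2 — `quadC` as an alternating 4-linear map; span bookkeeping; the projections `prᵢ`

From M19–M20 (by base change, `HodgeCM.Proofs.Prop22.Basic`): `(a,b,c,d) ↦ (a ∪ b) ∪ (c̄ ∪ d̄)`-free
version `quadC a b c d = (a ∪ b) ∪ (c ∪ d)` is ALTERNATING (`quadAlt`); a four-fold span-induction lemma
(`quadC_mem_span`); and the unfolding of the projections `pr4 i` of the left-nested product (M1).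
-/

noncomputable section

open scoped TensorProduct

namespace HodgeCM

open Literature.AlgebraicGeometry.Motives

namespace Universe

variable {U : Universe}

/-! ### The projections of `P = ((A₀ × A₁) × A₂) × A₃` -/

section pr4
variable {K : CMField} {Φ : Fin 4 → CMType K} (k : ℕ)

/-- (Ported verbatim from the HodgeCMPerL package; no docstring in the source.) -/
theorem pull_pr4_zero (M : U.ModelAxioms) (y : U.Coh (U.cmAV K (Φ 0)) k) : U.pull (U.pr4 K Φ 0) k y =
    U.pull (U.fst _ _) k (U.pull (U.fst _ _) k (U.pull (U.fst _ _) k y)) := by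
  show U.pull (U.comp (U.fst _ _) (U.comp (U.fst _ _) (U.fst _ _))) k y = _
  rw [M.pull_comp, M.pull_comp]; rfl

/-- (Ported verbatim from the HodgeCMPerL package; no docstring in the source.) -/
theorem pull_pr4_one (M : U.ModelAxioms) (y : U.Coh (U.cmAV K (Φ 1)) k) : U.pull (U.pr4 K Φ 1) k y =
    U.pull (U.fst _ _) k (U.pull (U.fst _ _) k (U.pull (U.snd _ _) k y)) := by
  show U.pull (U.comp (U.fst _ _) (U.comp (U.fst _ _) (U.snd _ _))) k y = _
  rw [M.pull_comp, M.pull_comp]; rfl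

/-- (Ported verbatim from the HodgeCMPerL package; no docstring in the source.) -/
theorem pull_pr4_two (M : U.ModelAxioms) (y : U.Coh (U.cmAV K (Φ 2)) k) : U.pull (U.pr4 K Φ 2) k y =
    U.pull (U.fst _ _) k (U.pull (U.snd _ _) k y) := by
  show U.pull (U.comp (U.fst _ _) (U.snd _ _)) k y = _
  rw [M.pull_comp]; rfl

/-- (Ported verbatim from the HodgeCMPerL package; no docstring in the source.) -/
theorem pull_pr4_three (y : U.Coh (U.cmAV K (Φ 3)) k) : U.pull (U.pr4 K Φ 3) k y = U.pull (U.snd _ _) k y :=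
  rfl

end pr4

/-! ### Slotwise scalars and vanishing of `quadC` on repeated arguments -/

/-- (Ported verbatim from the HodgeCMPerL package; no docstring in the source.) -/
theorem quadC_smul (X : U.Var) (c₀ c₁ c₂ c₃ : ℂ) (a b c d : U.CohC X 1) :
    U.quadC X (c₀ • a) (c₁ • b) (c₂ • c) (c₃ • d) = (c₀ * c₁ * c₂ * c₃) • U.quadC X a b c d := by
  simp only [Universe.quadC, map_smul, LinearMap.smul_apply, smul_smul]
  congr 1; ring

omit U in
/-- (Ported verbatim from the HodgeCMPerL package; no docstring in the source.) -/
private theorem eq_zero_of_eq_neg {V : Type*} [AddCommGroup V] [Module ℂ V] {x : V} (h : x = -x) : x = 0 := by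
  have h2 : (2 : ℂ) • x = 0 := by
    rw [two_smul]
    nth_rewrite 2 [h]
    exact add_neg_cancel x
  exact (smul_eq_zero.mp h2).resolve_left two_ne_zero

/-- (Ported verbatim from the HodgeCMPerL package; no docstring in the source.) -/
theorem cup2C_self (h1 : U.Fact_cup_comm1) (X : U.Var) (a : U.CohC X 1) : U.cup2C X 1 a a = 0 :=
  eq_zero_of_eq_neg (cup2C_comm1 h1 X a a)

section vanish
variable (h1 : U.Fact_cup_comm1) (h2 : U.Fact_cup_interchange) (X : U.Var) (a b c d : U.CohC X 1)
include h1

/-- (Ported verbatim from the HodgeCMPerL package; no docstring in the source.) -/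
theorem quadC_swap01 : U.quadC X a b c d = -U.quadC X b a c d := by
  simp only [Universe.quadC]; rw [cup2C_comm1 h1 X a b, map_neg, LinearMap.neg_apply]

/-- (Ported verbatim from the HodgeCMPerL package; no docstring in the source.) -/
theorem quadC_swap23 : U.quadC X a b c d = -U.quadC X a b d c := by
  simp only [Universe.quadC]; rw [cup2C_comm1 h1 X c d, map_neg]

omit h1 in
include h2 in
/-- (Ported verbatim from the HodgeCMPerL package; no docstring in the source.) -/
theorem quadC_swap12 : U.quadC X a b c d = -U.quadC X a c b d := by
  simp only [Universe.quadC]; rw [cup2C_interchange h2 X a b c d]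

/-- (Ported verbatim from the HodgeCMPerL package; no docstring in the source.) -/
theorem quadC_eq_zero01 : U.quadC X a a c d = 0 := by
  simp only [Universe.quadC]; rw [cup2C_self h1, map_zero, LinearMap.zero_apply]

/-- (Ported verbatim from the HodgeCMPerL package; no docstring in the source.) -/
theorem quadC_eq_zero23 : U.quadC X a b c c = 0 := by
  simp only [Universe.quadC]; rw [cup2C_self h1, map_zero]

omit h1 in
include h2 in
/-- (Ported verbatim from the HodgeCMPerL package; no docstring in the source.) -/
theorem quadC_eq_zero12 : U.quadC X a b b d = 0 :=
  eq_zero_of_eq_neg (quadC_swap12 h2 X a b b d)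

include h2 in
/-- (Ported verbatim from the HodgeCMPerL package; no docstring in the source.) -/
theorem quadC_eq_zero02 : U.quadC X a b a d = 0 := by
  rw [quadC_swap12 h2, quadC_eq_zero01 h1, neg_zero]

include h2 in
/-- (Ported verbatim from the HodgeCMPerL package; no docstring in the source.) -/
theorem quadC_eq_zero13 : U.quadC X a b c b = 0 := by
  rw [quadC_swap12 h2, quadC_eq_zero23 h1, neg_zero]

include h2 in
/-- (Ported verbatim from the HodgeCMPerL package; no docstring in the source.) -/
theorem quadC_eq_zero03 : U.quadC X a b c a = 0 := by
  rw [quadC_swap23 h1, quadC_eq_zero02 h1 h2, neg_zero]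

end vanish

/-! ### `quadC` as an alternating map -/

/-- (Ported verbatim from the HodgeCMPerL package; no docstring in the source.) -/
private theorem fin4_ne : ((1 : Fin 4) ≠ 0 ∧ (2 : Fin 4) ≠ 0 ∧ (3 : Fin 4) ≠ 0) ∧
    ((0 : Fin 4) ≠ 1 ∧ (2 : Fin 4) ≠ 1 ∧ (3 : Fin 4) ≠ 1) ∧
    ((0 : Fin 4) ≠ 2 ∧ (1 : Fin 4) ≠ 2 ∧ (3 : Fin 4) ≠ 2) ∧
    ((0 : Fin 4) ≠ 3 ∧ (1 : Fin 4) ≠ 3 ∧ (2 : Fin 4) ≠ 3) := by decide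

/-- `(v₀, v₁, v₂, v₃) ↦ (v₀ ∪ v₁) ∪ (v₂ ∪ v₃)` as an alternating `4`-linear map on `H¹(X, ℂ)`. -/
def quadAlt (h1 : U.Fact_cup_comm1) (h2 : U.Fact_cup_interchange) (X : U.Var) :
    U.CohC X 1 [⋀^Fin 4]→ₗ[ℂ] U.CohC X 4 where
  toFun v := U.quadC X (v 0) (v 1) (v 2) (v 3)
  map_update_add' v i x y := by
    obtain ⟨⟨a1, a2, a3⟩, ⟨b0, b2, b3⟩, ⟨c0, c1, c3⟩, ⟨d0, d1, d2⟩⟩ := fin4_ne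
    fin_cases i
    · simp only [Fin.zero_eta, Fin.isValue, Function.update_self, Function.update_of_ne a1,
        Function.update_of_ne a2, Function.update_of_ne a3, Universe.quadC, map_add, LinearMap.add_apply]
    · simp only [Fin.mk_one, Fin.isValue, Function.update_self, Function.update_of_ne b0,
        Function.update_of_ne b2, Function.update_of_ne b3, Universe.quadC, map_add, LinearMap.add_apply]
    · have e2 : (⟨2, by decide⟩ : Fin 4) = 2 := rfl
      simp only [e2, Function.update_self, Function.update_of_ne c0,
        Function.update_of_ne c1, Function.update_of_ne c3, Universe.quadC, map_add, LinearMap.add_apply]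
    · have e3 : (⟨3, by decide⟩ : Fin 4) = 3 := rfl
      simp only [e3, Function.update_self, Function.update_of_ne d0,
        Function.update_of_ne d1, Function.update_of_ne d2, Universe.quadC, map_add]
  map_update_smul' v i r x := by
    obtain ⟨⟨a1, a2, a3⟩, ⟨b0, b2, b3⟩, ⟨c0, c1, c3⟩, ⟨d0, d1, d2⟩⟩ := fin4_ne
    fin_cases i
    · simp only [Fin.zero_eta, Fin.isValue, Function.update_self, Function.update_of_ne a1,
        Function.update_of_ne a2, Function.update_of_ne a3, Universe.quadC, map_smul, LinearMap.smul_apply]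
    · simp only [Fin.mk_one, Fin.isValue, Function.update_self, Function.update_of_ne b0,
        Function.update_of_ne b2, Function.update_of_ne b3, Universe.quadC, map_smul, LinearMap.smul_apply]
    · have e2 : (⟨2, by decide⟩ : Fin 4) = 2 := rfl
      simp only [e2, Function.update_self, Function.update_of_ne c0,
        Function.update_of_ne c1, Function.update_of_ne c3, Universe.quadC, map_smul, LinearMap.smul_apply]
    · have e3 : (⟨3, by decide⟩ : Fin 4) = 3 := rfl
      simp only [e3, Function.update_self, Function.update_of_ne d0,
        Function.update_of_ne d1, Function.update_of_ne d2, Universe.quadC, map_smul]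
  map_eq_zero_of_eq' v i j hv hij := by
    -- explicit 16-way case split (trial-and-error unification on `Fin 4` literals is too slow)
    fin_cases i <;> fin_cases j
    · exact absurd rfl hij
    · have hv' : v 0 = v 1 := hv
      rw [hv']; exact quadC_eq_zero01 h1 X _ _ _
    · have hv' : v 0 = v 2 := hv
      rw [hv']; exact quadC_eq_zero02 h1 h2 X _ _ _
    · have hv' : v 0 = v 3 := hv
      rw [hv']; exact quadC_eq_zero03 h1 h2 X _ _ _
    · have hv' : v 1 = v 0 := hv
      rw [hv']; exact quadC_eq_zero01 h1 X _ _ _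
    · exact absurd rfl hij
    · have hv' : v 1 = v 2 := hv
      rw [hv']; exact quadC_eq_zero12 h2 X _ _ _
    · have hv' : v 1 = v 3 := hv
      rw [hv']; exact quadC_eq_zero13 h1 h2 X _ _ _
    · have hv' : v 2 = v 0 := hv
      rw [hv']; exact quadC_eq_zero02 h1 h2 X _ _ _
    · have hv' : v 2 = v 1 := hv
      rw [hv']; exact quadC_eq_zero12 h2 X _ _ _
    · exact absurd rfl hij
    · have hv' : v 2 = v 3 := hv
      rw [hv']; exact quadC_eq_zero23 h1 X _ _ _
    · have hv' : v 3 = v 0 := hv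
      rw [hv']; exact quadC_eq_zero03 h1 h2 X _ _ _
    · have hv' : v 3 = v 1 := hv
      rw [hv']; exact quadC_eq_zero13 h1 h2 X _ _ _
    · have hv' : v 3 = v 2 := hv
      rw [hv']; exact quadC_eq_zero23 h1 X _ _ _
    · exact absurd rfl hij

/-- (Ported verbatim from the HodgeCMPerL package; no docstring in the source.) -/
@[simp] theorem quadAlt_apply (h1 : U.Fact_cup_comm1) (h2 : U.Fact_cup_interchange) (X : U.Var)
    (v : Fin 4 → U.CohC X 1) : U.quadAlt h1 h2 X v = U.quadC X (v 0) (v 1) (v 2) (v 3) := rfl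

/-- On arguments drawn from four given classes `e₀,…,e₃`, `quadC` takes values in the line through
`quadC e₀ e₁ e₂ e₃`. -/
theorem quadC_comp_mem_span_singleton (h1 : U.Fact_cup_comm1) (h2 : U.Fact_cup_interchange) (X : U.Var)
    (e : Fin 4 → U.CohC X 1) (p : Fin 4 → Fin 4) :
    U.quadC X (e (p 0)) (e (p 1)) (e (p 2)) (e (p 3)) ∈ ℂ ∙ U.quadC X (e 0) (e 1) (e 2) (e 3) := by
  change U.quadAlt h1 h2 X (e ∘ p) ∈ ℂ ∙ U.quadAlt h1 h2 X e
  by_cases hp : Function.Injective p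
  · have hb : Function.Bijective p := Finite.injective_iff_bijective.mp hp
    rw [show e ∘ p = e ∘ (Equiv.ofBijective p hb) from rfl, AlternatingMap.map_perm]
    rcases Int.units_eq_one_or (Equiv.Perm.sign (Equiv.ofBijective p hb)) with h | h
    · rw [h, one_smul]; exact Submodule.mem_span_singleton_self _
    · rw [h, Units.neg_smul, one_smul]; exact Submodule.neg_mem _ (Submodule.mem_span_singleton_self _)
  · rw [AlternatingMap.map_eq_zero_of_not_injective _ _ fun h => hp (h.of_comp)]
    exact Submodule.zero_mem _

/-! ### Four-fold span induction -/

/-- (Ported verbatim from the HodgeCMPerL package; no docstring in the source.) -/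
theorem quadC_mem_span {ι : Type*} (X : U.Var) (u : ι → U.CohC X 1) (S : Submodule ℂ (U.CohC X 4))
    (hS : ∀ p : Fin 4 → ι, U.quadC X (u (p 0)) (u (p 1)) (u (p 2)) (u (p 3)) ∈ S)
    {a b c d : U.CohC X 1} (ha : a ∈ Submodule.span ℂ (Set.range u)) (hb : b ∈ Submodule.span ℂ (Set.range u))
    (hc : c ∈ Submodule.span ℂ (Set.range u)) (hd : d ∈ Submodule.span ℂ (Set.range u)) :
    U.quadC X a b c d ∈ S := by
  have s4 : ∀ i j k, ∀ d ∈ Submodule.span ℂ (Set.range u), U.quadC X (u i) (u j) (u k) d ∈ S := by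
    intro i j k d hd
    induction hd using Submodule.span_induction with
    | mem d hd => obtain ⟨l, rfl⟩ := hd; simpa using hS ![i, j, k, l]
    | zero => simp [Universe.quadC]
    | add d d' _ _ h h' => simpa [Universe.quadC, map_add] using add_mem h h'
    | smul r d _ h => simpa [Universe.quadC, map_smul] using S.smul_mem r h
  have s3 : ∀ i j, ∀ c ∈ Submodule.span ℂ (Set.range u), ∀ d ∈ Submodule.span ℂ (Set.range u),
      U.quadC X (u i) (u j) c d ∈ S := by
    intro i j c hc
    induction hc using Submodule.span_induction with
    | mem c hc => obtain ⟨k, rfl⟩ := hc; exact s4 i j k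
    | zero => intros; simp [Universe.quadC]
    | add c c' _ _ h h' =>
      intro d hd; simpa [Universe.quadC, map_add, LinearMap.add_apply] using add_mem (h d hd) (h' d hd)
    | smul r c _ h =>
      intro d hd; simpa [Universe.quadC, map_smul, LinearMap.smul_apply] using S.smul_mem r (h d hd)
  have s2 : ∀ i, ∀ b ∈ Submodule.span ℂ (Set.range u), ∀ c ∈ Submodule.span ℂ (Set.range u),
      ∀ d ∈ Submodule.span ℂ (Set.range u), U.quadC X (u i) b c d ∈ S := by
    intro i b hb
    induction hb using Submodule.span_induction with
    | mem b hb => obtain ⟨j, rfl⟩ := hb; exact s3 i j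
    | zero => intros; simp [Universe.quadC]
    | add b b' _ _ h h' =>
      intro c hc d hd
      simpa [Universe.quadC, map_add, LinearMap.add_apply] using add_mem (h c hc d hd) (h' c hc d hd)
    | smul r b _ h =>
      intro c hc d hd
      simpa [Universe.quadC, map_smul, LinearMap.smul_apply] using S.smul_mem r (h c hc d hd)
  have s1 : ∀ a ∈ Submodule.span ℂ (Set.range u), ∀ b ∈ Submodule.span ℂ (Set.range u),
      ∀ c ∈ Submodule.span ℂ (Set.range u), ∀ d ∈ Submodule.span ℂ (Set.range u), U.quadC X a b c d ∈ S := by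
    intro a ha
    induction ha using Submodule.span_induction with
    | mem a ha => obtain ⟨i, rfl⟩ := ha; exact s2 i
    | zero => intros; simp [Universe.quadC]
    | add a a' _ _ h h' =>
      intro b hb c hc d hd
      simpa [Universe.quadC, map_add, LinearMap.add_apply] using add_mem (h b hb c hc d hd) (h' b hb c hc d hd)
    | smul r a _ h =>
      intro b hb c hc d hd
      simpa [Universe.quadC, map_smul, LinearMap.smul_apply] using S.smul_mem r (h b hb c hc d hd)
  exact s1 a ha b hb c hc d hd

end Universe

end HodgeCM

end
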